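import Mathlib

/-!
# Similar sublattices of A₂₈ of norm 167: the glue lemma, step 1 (kernel)

Framing: lottery ticket; floor = certified bounds/negative ranges.

Cell pub-namedobj (venture DiscreteObjects), target (H), hadamard gen 9 (FAMILY-F12-G9 §2, Proposition 2.1).  Let
`u_1, …, u_28 ∈ ℤ²⁹` have coordinate sums `0` and Gram matrix `167·(I + J)` — i.e. they span a sublattice of the root lattice
`A₂₈ = {x ∈ ℤ²⁹ : Σ x = 0}` isometric to `√167·A₂₈` (the `u_i` play the basis `e_i − e_29`).  **`sum_congr_mod29`: all coordinates
of `S := Σ_i u_i` are congruent modulo `29`.**  Proof over `F = ZMod 29`: `⟨S, u_j⟩ = 167·29 ≡ 0` and `S ≢ 0` (else `29² ∣ |S|² =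
28·167·29`); the map `n ↦ Σ n_j ū_j` from `F²⁸` to the zero-sum vectors of `F²⁹` is injective (a relation forces all `n_j` equal,
`n_j = t`, and then `t·S̄ = 0`), hence bijective by counting (`zeroSumEquiv`), so every `e_k − e_l` is an `F`-combination of the
`ū_j` and `S̄_k − S̄_l = ⟨S̄, e_k − e_l⟩ = 0`.  (This is the statement 'the multiplier preserves the radical of `A₂₈/29A₂₈`'.)
Used in `OrbitMatrixFromMultiplier` to turn any such `u` into a fixed-point-free Z₂₃ orbit matrix of H(668).
Ours, not literature; no `sorry`.
-/
open Finset BigOperators Matrix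

namespace Summit.Ventures.DiscreteObjects.Hadamard.SimilarSublattice

/-- sum of the Gram row: `Σ_x (if x = j then 334 else 167) = 4843` -/
private lemma gram_row_sum (j : Fin 28) : ∑ x : Fin 28, (if x = j then (334 : ℤ) else 167) = 4843 := by
  have : ∀ x : Fin 28, (if x = j then (334 : ℤ) else 167) = 167 + (if x = j then 167 else 0) := by
    intro x; split_ifs <;> norm_num
  simp_rw [this]
  rw [Finset.sum_add_distrib, Finset.sum_ite_eq' Finset.univ j, if_pos (Finset.mem_univ j), Finset.sum_const,
    Finset.card_univ, Fintype.card_fin]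
  norm_num

/-- **Glue lemma, step 1.** For `u : Fin 28 → ℤ²⁹` with zero coordinate sums and Gram matrix `167 (I + J)`, all
coordinates of `S = Σ_i u_i` are congruent mod `29`. -/
theorem sum_congr_mod29 (u : Fin 28 → Fin 29 → ℤ) (hsum : ∀ i, ∑ k, u i k = 0)
    (hgram : ∀ i j, ∑ k, u i k * u j k = if i = j then 334 else 167) (k l : Fin 29) :
    (29 : ℤ) ∣ (∑ i, u i k) - (∑ i, u i l) := by
  have h4843 : (4843 : ZMod 29) = 0 := by decide
  have h167 : (167 : ZMod 29) ≠ 0 := by decide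
  haveI hp29 : Fact (Nat.Prime 29) := ⟨by norm_num⟩
  -- zero-sum vectors over F are parametrised by their first 28 coordinates
  have zeroSumEquiv : {x : Fin 29 → ZMod 29 // ∑ k, x k = 0} ≃ (Fin 28 → ZMod 29) :=
    { toFun := fun x => fun k => x.1 (Fin.castSucc k)
      invFun := fun y => ⟨Fin.snoc y (-∑ k, y k), by
        rw [Fin.sum_univ_castSucc, Fin.snoc_last]
        simp only [Fin.snoc_castSucc]
        ring⟩
      left_inv := fun x => by
        apply Subtype.ext
        funext k
        refine Fin.lastCases ?_ (fun i => ?_) k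
        · show Fin.snoc (α := fun _ => ZMod 29) (fun k => x.1 (Fin.castSucc k)) (-∑ k, x.1 (Fin.castSucc k)) (Fin.last 28)
              = x.1 (Fin.last 28)
          rw [Fin.snoc_last]
          have h := x.2
          rw [Fin.sum_univ_castSucc] at h
          linear_combination -h
        · show Fin.snoc (α := fun _ => ZMod 29) (fun k => x.1 (Fin.castSucc k)) (-∑ k, x.1 (Fin.castSucc k)) (Fin.castSucc i)
              = x.1 (Fin.castSucc i)
          rw [Fin.snoc_castSucc]
      right_inv := fun y => by
        funext k
        show Fin.snoc (α := fun _ => ZMod 29) y (-∑ k, y k) (Fin.castSucc k) = y k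
        rw [Fin.snoc_castSucc] }
  -- integer facts
  have hz : ∀ j, ∑ k, (∑ i, u i k) * u j k = 4843 := by
    intro j
    simp only [Finset.sum_mul]
    rw [Finset.sum_comm]
    have : ∀ i, ∑ k, u i k * u j k = if i = j then 334 else 167 := fun i => hgram i j
    simp_rw [this]
    exact gram_row_sum j
  have hS2 : ∑ k, (∑ i, u i k) * (∑ i, u i k) = 135604 := by
    simp_rw [Finset.sum_mul_sum]
    rw [Finset.sum_comm]
    have inner : ∀ i, ∑ k, ∑ j, u i k * u j k = ∑ j, ∑ k, u i k * u j k := fun i => Finset.sum_comm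
    simp_rw [inner, hgram]
    decide
  -- over F = ZMod 29
  set ub : Fin 28 → Fin 29 → ZMod 29 := fun i k => ((u i k : ℤ) : ZMod 29) with hub
  set SZ : Fin 29 → ZMod 29 := fun k => ∑ i, ub i k with hSZ
  have hSZ_cast : ∀ k, SZ k = (((∑ i, u i k : ℤ)) : ZMod 29) := by
    intro k; rw [hSZ, hub]; push_cast; rfl
  have hSu : ∀ j, ∑ k, SZ k * ub j k = 0 := by
    intro j
    have e : ((∑ k, (∑ i, u i k) * u j k : ℤ) : ZMod 29) = ((4843 : ℤ) : ZMod 29) := by rw [hz j]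
    push_cast at e
    rw [h4843] at e
    rw [← e]
  have hSZ_ne : SZ ≠ 0 := by
    intro h0
    have hdiv : ∀ k, (29 : ℤ) ∣ ∑ i, u i k := by
      intro k
      have := congrFun h0 k
      rw [hSZ_cast k, Pi.zero_apply] at this
      exact (ZMod.intCast_zmod_eq_zero_iff_dvd _ 29).mp this
    have h841 : (841 : ℤ) ∣ ∑ k, (∑ i, u i k) * (∑ i, u i k) := by
      apply Finset.dvd_sum
      intro k _
      obtain ⟨m, hm⟩ := hdiv k
      exact ⟨m * m, by rw [hm]; ring⟩
    rw [hS2] at h841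
    omega
  have hubsum : ∀ j, ∑ k, ub j k = 0 := by
    intro j
    have h1 : ((∑ k, u j k : ℤ) : ZMod 29) = ((0 : ℤ) : ZMod 29) := by rw [hsum j]
    push_cast at h1
    rw [hub]
    exact h1
  have hgramb : ∀ i j, ∑ k, ub i k * ub j k = if i = j then (334 : ZMod 29) else 167 := by
    intro i j
    have h1 : ((∑ k, u i k * u j k : ℤ) : ZMod 29) = ((if i = j then 334 else 167 : ℤ) : ZMod 29) := by rw [hgram i j]
    push_cast at h1
    rw [hub]
    rw [h1]
  -- the linear map φ
  let φ : (Fin 28 → ZMod 29) → {x : Fin 29 → ZMod 29 // ∑ k, x k = 0} := fun n =>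
    ⟨fun k => ∑ j, n j * ub j k, by
      rw [Finset.sum_comm]
      have : ∀ j, ∑ k, n j * ub j k = 0 := fun j => by rw [← Finset.mul_sum, hubsum j, mul_zero]
      simp_rw [this]
      simp⟩
  have hφ : ∀ n t, (φ n).1 t = ∑ j, n j * ub j t := fun n t => rfl
  -- injectivity
  have hinj : Function.Injective φ := by
    intro n n' hnn'
    set m : Fin 28 → ZMod 29 := fun j => n j - n' j with hm
    have hd : ∀ k, ∑ j, m j * ub j k = 0 := by
      intro k
      have := congrArg (fun x : {x : Fin 29 → ZMod 29 // ∑ k, x k = 0} => x.1 k) hnn'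
      simp only [hφ] at this
      rw [hm]
      simp only [sub_mul, Finset.sum_sub_distrib, this, sub_self]
    have hM : ∀ i, (167 : ZMod 29) * m i + 167 * ∑ j, m j = 0 := by
      intro i
      have h0 : ∑ k, (∑ j, m j * ub j k) * ub i k = 0 := by
        simp_rw [hd]; simp
      have e1 : ∑ k, (∑ j, m j * ub j k) * ub i k = ∑ j, m j * ∑ k, ub j k * ub i k := by
        simp_rw [Finset.sum_mul, Finset.mul_sum, mul_assoc]
        exact Finset.sum_comm
      rw [e1] at h0
      simp_rw [hgramb] at h0
      have e2 : ∀ j, m j * (if j = i then (334 : ZMod 29) else 167) = 167 * m j + (if j = i then 167 * m j else 0) := by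
        intro j
        split_ifs <;> ring
      simp_rw [e2] at h0
      rw [Finset.sum_add_distrib, ← Finset.mul_sum, Finset.sum_ite_eq' Finset.univ i, if_pos (Finset.mem_univ i)] at h0
      linear_combination h0
    have hconst : ∀ i, m i = m 0 := by
      intro i
      have : (167 : ZMod 29) * (m i - m 0) = 0 := by linear_combination hM i - hM 0
      rcases mul_eq_zero.mp this with h | h
      · exact absurd h h167
      · exact sub_eq_zero.mp h
    have hm0 : m 0 = 0 := by
      by_contra hne
      apply hSZ_ne
      funext k
      have hk' := hd k
      simp_rw [hconst] at hk'
      rw [← Finset.mul_sum] at hk'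
      rcases mul_eq_zero.mp hk' with h | h
      · exact absurd h hne
      · rw [Pi.zero_apply, hSZ]; exact h
    funext j
    have := hconst j
    rw [hm0, hm] at this
    exact sub_eq_zero.mp this
  have hcard : Fintype.card (Fin 28 → ZMod 29) = Fintype.card {x : Fin 29 → ZMod 29 // ∑ k, x k = 0} :=
    (Fintype.card_congr zeroSumEquiv).symm
  have hbij : Function.Bijective φ := (Fintype.bijective_iff_injective_and_card φ).mpr ⟨hinj, hcard⟩
  -- e_k − e_l is a zero-sum vector, hence in the image
  obtain ⟨n, hn⟩ := hbij.2 ⟨fun t => (if t = k then 1 else 0) - (if t = l then 1 else 0), by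
    rw [Finset.sum_sub_distrib, Finset.sum_ite_eq' Finset.univ k, Finset.sum_ite_eq' Finset.univ l]
    simp⟩
  have h2 : ∀ t, ((if t = k then (1 : ZMod 29) else 0) - (if t = l then 1 else 0)) = ∑ j, n j * ub j t := by
    intro t
    have := congrArg (fun x : {x : Fin 29 → ZMod 29 // ∑ k, x k = 0} => x.1 t) hn
    simp only [hφ] at this
    exact this.symm
  have hfinal : SZ k - SZ l = 0 := by
    have h1 : ∑ t, SZ t * ((if t = k then (1 : ZMod 29) else 0) - (if t = l then 1 else 0)) = SZ k - SZ l := by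
      simp_rw [mul_sub, Finset.sum_sub_distrib, mul_ite, mul_one, mul_zero]
      rw [Finset.sum_ite_eq' Finset.univ k, Finset.sum_ite_eq' Finset.univ l]
      simp
    rw [← h1]
    simp_rw [h2]
    have e3 : ∑ t, SZ t * ∑ j, n j * ub j t = ∑ j, n j * ∑ t, SZ t * ub j t := by
      simp_rw [Finset.mul_sum]
      rw [Finset.sum_comm]
      apply Finset.sum_congr rfl; intro j _
      apply Finset.sum_congr rfl; intro t _
      ring
    rw [e3]
    simp_rw [hSu]
    simp
  have h3 : (((∑ i, u i k) - (∑ i, u i l) : ℤ) : ZMod 29) = 0 := by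
    rw [Int.cast_sub, ← hSZ_cast k, ← hSZ_cast l]; exact hfinal
  exact (ZMod.intCast_zmod_eq_zero_iff_dvd _ 29).mp h3

end Summit.Ventures.DiscreteObjects.Hadamard.SimilarSublattice
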